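import Mathlib
import Literature.Probability.Moments.HoeffdingCounting
import Summits.PneNP.PneNP.Theorems.OverlapGapAlgebraSolvableImpliesStableSectionUnsatRegime

/-!
# PneNP / OverlapGapAlgebra — crux `SolvableImpliesStableSection` (stmt-PneNP-2463):
# the DENSITY LIFT block (1/3) — a conditional Hoeffding bound for violated tail clauses

Support for crux `stmt-PneNP-2463` (`Summit.PneNP.PneNP.Theses.OverlapGapAlgebra.SolvableImpliesStableSection`).
The block proves that the f-free CONCLUSION of the crux is monotone UPWARD in the clause density:
a good section at density `α'` lifts to density `α ≥ α'` (solve the first `⌊α' n⌋` clauses, ignore the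
rest) at the price `2^{-k}(1 - α'/α)` in the validity level `ν`.  This file is the probabilistic
input: on the uniform space of two-level families `Ψ : ι₁ → ι₂ → (Fin k → Fin n × Bool)` of clauses,
if an assignment `σ(Ψ)` does not depend on the coordinates `(ρ a, a)`, `a ∈ J` (a set of columns with a
row selector `ρ`), then the number of columns `a ∈ J` whose clause `Ψ (ρ a) a` is violated by `σ(Ψ)`
exceeds its mean `2^{-k}·#J` by `t` on at most `exp(-t²/(2·#J))·#families` families
(`sissDL_card_violTail_le`).  Mechanism: Hoeffding's
lemma for one clause (`Literature.Probability.Moments.hoeffding_lemma_sum`), an exponential-moment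
induction over `J` driven by a two-level re-randomisation identity (`sissDL_rerandomize₂`), Markov.

* `sissDL_rerandomize₂` — re-randomising one coordinate of a two-level family;
* `sissDL_sum_exp_centred_le` — Hoeffding's lemma for the centred violation indicator of one clause;
* `sissDL_expMoment_le` — the exponential moment of the centred violated-tail count;
* `sissDL_card_violTail_le` — the tail bound; `sissDL_card_violTail_paths_le` — on path tuples (registered).
No definitions; axioms `propext`, `Classical.choice`, `Quot.sound`.
-/

set_option linter.dupNamespace false -- `Summit.PneNP.PneNP.…`: summit = sub-problem (D-0017)

namespace Summit.PneNP.PneNP.Theorems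

open Finset
open scoped Classical

open Summit.PneNP.PneNP.Cruxes.SolvableImpliesStableSection.Sketch (ur_card_unsatClauses)

section DensityLiftHoeffding

/-- **Re-randomising one coordinate of a two-level family.** On the uniform space `ι₁ → ι₂ → C`, if
`R` does not depend on coordinate `(ρ, a)`, then `#C · Σ_Ψ h (Ψ ρ a) (R Ψ) = Σ_Ψ Σ_c h c (R Ψ)`: the
involution `(Ψ, c) ↦ (Ψ with Ψ ρ a := c, Ψ ρ a)` matches the two double sums term by term. -/
theorem sissDL_rerandomize₂ {ι₁ ι₂ C β : Type*} [Fintype ι₁] [DecidableEq ι₁] [Fintype ι₂]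
    [DecidableEq ι₂] [Fintype C] (ρ : ι₁) (a : ι₂) (R : (ι₁ → ι₂ → C) → β)
    (hR : ∀ (Ψ : ι₁ → ι₂ → C) (c : C), R (Function.update Ψ ρ (Function.update (Ψ ρ) a c)) = R Ψ)
    (h : C → β → ℝ) :
    (Fintype.card C : ℝ) * ∑ Ψ : ι₁ → ι₂ → C, h (Ψ ρ a) (R Ψ) =
      ∑ Ψ : ι₁ → ι₂ → C, ∑ c : C, h c (R Ψ) := by
  have hσ : Function.Involutive
      (fun p : (ι₁ → ι₂ → C) × C =>
        (Function.update p.1 ρ (Function.update (p.1 ρ) a p.2), p.1 ρ a)) := by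
    rintro ⟨Ψ, c⟩
    simp only [Function.update_self, Prod.mk.injEq]
    refine ⟨?_, trivial⟩
    funext ρ' a'
    by_cases hρ : ρ' = ρ
    · subst hρ
      simp only [Function.update_self]
      by_cases ha : a' = a
      · subst ha; simp
      · simp [Function.update_of_ne ha]
    · simp [Function.update_of_ne hρ]
  calc (Fintype.card C : ℝ) * ∑ Ψ : ι₁ → ι₂ → C, h (Ψ ρ a) (R Ψ)
      = ∑ Ψ : ι₁ → ι₂ → C, ∑ _c : C, h (Ψ ρ a) (R Ψ) := by
        simp [mul_sum]
    _ = ∑ p : (ι₁ → ι₂ → C) × C, h (p.1 ρ a) (R p.1) :=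
        (Fintype.sum_prod_type' fun (Ψ : ι₁ → ι₂ → C) (_c : C) => h (Ψ ρ a) (R Ψ)).symm
    _ = ∑ p : (ι₁ → ι₂ → C) × C, h p.2 (R p.1) := by
        refine Fintype.sum_bijective _ hσ.bijective _ _ fun p => ?_
        simp only [hR]
    _ = ∑ Ψ : ι₁ → ι₂ → C, ∑ c : C, h c (R Ψ) :=
        Fintype.sum_prod_type' fun (Ψ : ι₁ → ι₂ → C) (c : C) => h c (R Ψ)

variable {k n : ℕ}

/-- The violation indicator of a clause sums to `n^k` over the `(2n)^k` clauses. -/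
theorem sissDL_sum_violInd (σ : Fin n → Bool) :
    ∑ c : Fin k → Fin n × Bool, (if ∀ b, σ (c b).1 ≠ (c b).2 then (1 : ℝ) else 0) = (n : ℝ) ^ k := by
  rw [← Finset.natCast_card_filter (fun c : Fin k → Fin n × Bool => ∀ b, σ (c b).1 ≠ (c b).2),
    ur_card_unsatClauses n k σ]
  push_cast; rfl

/-- `#clauses = (2n)^k`, over `ℝ`. -/
theorem sissDL_card_clause : (Fintype.card (Fin k → Fin n × Bool) : ℝ) = (2 * (n : ℝ)) ^ k := by
  rw [Fintype.card_fun, Fintype.card_prod, Fintype.card_fin, Fintype.card_fin, Fintype.card_bool]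
  push_cast; ring

/-- The centred violation indicator `1[σ violates c] - n^k/(2n)^k` has mean zero (`n ≥ 1`). -/
theorem sissDL_sum_centred (hn : 1 ≤ n) (σ : Fin n → Bool) :
    ∑ c : Fin k → Fin n × Bool,
      ((if ∀ b, σ (c b).1 ≠ (c b).2 then (1 : ℝ) else 0) - (n : ℝ) ^ k / (2 * (n : ℝ)) ^ k) = 0 := by
  have hpos : (0 : ℝ) < (2 * (n : ℝ)) ^ k := by
    have : (1 : ℝ) ≤ n := by exact_mod_cast hn
    positivity
  rw [sum_sub_distrib, sissDL_sum_violInd, sum_const, card_univ, nsmul_eq_mul, sissDL_card_clause,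
    mul_div_cancel₀ _ hpos.ne', sub_self]

/-- The centred violation indicator is bounded by `1` in absolute value. -/
theorem sissDL_abs_centred_le (σ : Fin n → Bool) (c : Fin k → Fin n × Bool) :
    |(if ∀ b, σ (c b).1 ≠ (c b).2 then (1 : ℝ) else 0) - (n : ℝ) ^ k / (2 * (n : ℝ)) ^ k| ≤ 1 := by
  have hp0 : (0 : ℝ) ≤ (n : ℝ) ^ k / (2 * (n : ℝ)) ^ k := by positivity
  have hp1 : (n : ℝ) ^ k / (2 * (n : ℝ)) ^ k ≤ 1 := by
    rcases Nat.eq_zero_or_pos n with h0 | hpos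
    · subst h0
      rcases Nat.eq_zero_or_pos k with hk | hk
      · subst hk; simp
      · simp [zero_pow hk.ne']
    · have h2 : (n : ℝ) ^ k ≤ (2 * (n : ℝ)) ^ k :=
        pow_le_pow_left₀ (Nat.cast_nonneg _) (by linarith [(Nat.cast_nonneg n : (0 : ℝ) ≤ n)]) k
      have hpos' : (0 : ℝ) < (2 * (n : ℝ)) ^ k := by
        have : (0 : ℝ) < n := by exact_mod_cast hpos
        positivity
      exact (div_le_one hpos').2 h2
  split_ifs <;> rw [abs_le] <;> constructor <;> linarith

/-- **Hoeffding's lemma for one clause.** `Σ_c exp(l·(1[σ violates c] - 2^{-k})) ≤ #clauses · e^{l²/2}`. -/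
theorem sissDL_sum_exp_centred_le (hn : 1 ≤ n) (σ : Fin n → Bool) (l : ℝ) :
    ∑ c : Fin k → Fin n × Bool, Real.exp (l *
      ((if ∀ b, σ (c b).1 ≠ (c b).2 then (1 : ℝ) else 0) - (n : ℝ) ^ k / (2 * (n : ℝ)) ^ k)) ≤
      (Fintype.card (Fin k → Fin n × Bool) : ℝ) * Real.exp (l ^ 2 / 2) := by
  have h := Literature.Probability.Moments.hoeffding_lemma_sum (univ : Finset (Fin k → Fin n × Bool))
    (fun c => (if ∀ b, σ (c b).1 ≠ (c b).2 then (1 : ℝ) else 0) - (n : ℝ) ^ k / (2 * (n : ℝ)) ^ k)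
    (c := 1) (sissDL_sum_centred hn σ) (fun c _ => sissDL_abs_centred_le σ c) l
  simpa [card_univ] using h

/-- Updating coordinate `(ρ, a)` of a two-level family does not change the coordinates `(ρ', a')`
with `a' ≠ a`. -/
theorem sissDL_update₂_apply_of_ne {ι₁ ι₂ C : Type*} [DecidableEq ι₁] [DecidableEq ι₂]
    (Ψ : ι₁ → ι₂ → C) (ρ : ι₁) (a : ι₂) (c : C) (ρ' : ι₁) (a' : ι₂) (ha : a' ≠ a) :
    Function.update Ψ ρ (Function.update (Ψ ρ) a c) ρ' a' = Ψ ρ' a' := by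
  by_cases hρ : ρ' = ρ
  · subst hρ
    simp [Function.update_of_ne ha]
  · simp [Function.update_of_ne hρ]

/-- **The exponential moment of the centred violated-tail count.** Coordinates are indexed by a set
`J` of columns `a` and a row selector `ρ` (coordinate `(ρ a, a)`).  If the assignment `σ Ψ` does not
depend on these coordinates of `Ψ`, then
`Σ_Ψ exp(l · Σ_{a ∈ J} (1[σ Ψ violates Ψ (ρ a) a] - 2^{-k})) ≤ exp(#J · l²/2) · #families`. -/
theorem sissDL_expMoment_le {ι₁ ι₂ : Type*} [Fintype ι₁] [DecidableEq ι₁] [Fintype ι₂]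
    [DecidableEq ι₂] (hn : 1 ≤ n) (l : ℝ) (J : Finset ι₂) (ρ : ι₂ → ι₁)
    (σ : (ι₁ → ι₂ → (Fin k → Fin n × Bool)) → (Fin n → Bool))
    (hσ : ∀ a ∈ J, ∀ (Ψ : ι₁ → ι₂ → (Fin k → Fin n × Bool)) (c : Fin k → Fin n × Bool),
      σ (Function.update Ψ (ρ a) (Function.update (Ψ (ρ a)) a c)) = σ Ψ) :
    ∑ Ψ : ι₁ → ι₂ → (Fin k → Fin n × Bool), Real.exp (l * ∑ a ∈ J,
      ((if ∀ b, σ Ψ ((Ψ (ρ a) a b).1) ≠ (Ψ (ρ a) a b).2 then (1 : ℝ) else 0) -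
        (n : ℝ) ^ k / (2 * (n : ℝ)) ^ k)) ≤
      Real.exp (J.card * l ^ 2 / 2) * Fintype.card (ι₁ → ι₂ → (Fin k → Fin n × Bool)) := by
  induction J using Finset.induction_on with
  | empty => simp
  | @insert a₀ J' ha₀ ih =>
    have hσJ' : ∀ a ∈ J', ∀ (Ψ : ι₁ → ι₂ → (Fin k → Fin n × Bool)) (c : Fin k → Fin n × Bool),
        σ (Function.update Ψ (ρ a) (Function.update (Ψ (ρ a)) a c)) = σ Ψ :=
      fun a ha => hσ a (mem_insert_of_mem ha)
    have hσ₀ := hσ a₀ (mem_insert_self _ _)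
    have ih' := ih hσJ'
    -- abbreviations
    set p : ℝ := (n : ℝ) ^ k / (2 * (n : ℝ)) ^ k with hp
    set S' : (ι₁ → ι₂ → (Fin k → Fin n × Bool)) → ℝ := fun Ψ => ∑ a ∈ J',
      ((if ∀ b, σ Ψ ((Ψ (ρ a) a b).1) ≠ (Ψ (ρ a) a b).2 then (1 : ℝ) else 0) - p) with hS'
    have hsplit : ∀ Ψ : ι₁ → ι₂ → (Fin k → Fin n × Bool),
        Real.exp (l * ∑ a ∈ insert a₀ J',
          ((if ∀ b, σ Ψ ((Ψ (ρ a) a b).1) ≠ (Ψ (ρ a) a b).2 then (1 : ℝ) else 0) - p)) =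
        Real.exp (l * ((if ∀ b, σ Ψ ((Ψ (ρ a₀) a₀ b).1) ≠ (Ψ (ρ a₀) a₀ b).2 then (1 : ℝ) else 0) - p)) *
          Real.exp (l * S' Ψ) := by
      intro Ψ
      rw [sum_insert ha₀, mul_add, Real.exp_add]
    simp_rw [hsplit]
    -- `R Ψ := (σ Ψ, exp(l S' Ψ))` does not depend on coordinate `(ρ a₀, a₀)`
    have hS'inv : ∀ (Ψ : ι₁ → ι₂ → (Fin k → Fin n × Bool)) (c : Fin k → Fin n × Bool),
        S' (Function.update Ψ (ρ a₀) (Function.update (Ψ (ρ a₀)) a₀ c)) = S' Ψ := by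
      intro Ψ c
      simp only [hS']
      refine sum_congr rfl fun a ha => ?_
      have hne : a ≠ a₀ := by
        rintro rfl; exact ha₀ ha
      rw [hσ₀ Ψ c, sissDL_update₂_apply_of_ne Ψ (ρ a₀) a₀ c (ρ a) a hne]
    have hR : ∀ (Ψ : ι₁ → ι₂ → (Fin k → Fin n × Bool)) (c : Fin k → Fin n × Bool),
        (fun Ψ => (σ Ψ, Real.exp (l * S' Ψ)))
            (Function.update Ψ (ρ a₀) (Function.update (Ψ (ρ a₀)) a₀ c))
          = (fun Ψ => (σ Ψ, Real.exp (l * S' Ψ))) Ψ := by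
      intro Ψ c
      simp only [hσ₀ Ψ c, hS'inv Ψ c]
    have hrr := sissDL_rerandomize₂ (ρ a₀) a₀ (fun Ψ => (σ Ψ, Real.exp (l * S' Ψ))) hR
      (fun c βx => Real.exp (l * ((if ∀ b, βx.1 ((c b).1) ≠ (c b).2 then (1 : ℝ) else 0) - p)) * βx.2)
    simp only at hrr
    -- the inner sum is bounded by Hoeffding's lemma
    have hC : (0 : ℝ) < Fintype.card (Fin k → Fin n × Bool) := by
      rw [sissDL_card_clause]
      have : (1 : ℝ) ≤ n := by exact_mod_cast hn
      positivity
    have hinner : ∀ Ψ : ι₁ → ι₂ → (Fin k → Fin n × Bool),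
        ∑ c : Fin k → Fin n × Bool,
          Real.exp (l * ((if ∀ b, σ Ψ ((c b).1) ≠ (c b).2 then (1 : ℝ) else 0) - p)) * Real.exp (l * S' Ψ)
          ≤ (Fintype.card (Fin k → Fin n × Bool) : ℝ) * Real.exp (l ^ 2 / 2) * Real.exp (l * S' Ψ) := by
      intro Ψ
      rw [← sum_mul]
      exact mul_le_mul_of_nonneg_right (sissDL_sum_exp_centred_le hn (σ Ψ) l) (Real.exp_pos _).le
    have hsum : (Fintype.card (Fin k → Fin n × Bool) : ℝ) *
        ∑ Ψ : ι₁ → ι₂ → (Fin k → Fin n × Bool),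
          Real.exp (l * ((if ∀ b, σ Ψ ((Ψ (ρ a₀) a₀ b).1) ≠ (Ψ (ρ a₀) a₀ b).2 then (1 : ℝ) else 0) - p)) *
            Real.exp (l * S' Ψ)
        ≤ (Fintype.card (Fin k → Fin n × Bool) : ℝ) * (Real.exp (l ^ 2 / 2) *
          ∑ Ψ : ι₁ → ι₂ → (Fin k → Fin n × Bool), Real.exp (l * S' Ψ)) := by
      rw [hrr, mul_sum, mul_sum]
      refine sum_le_sum fun Ψ _ => ?_
      have := hinner Ψ
      linarith [this]
    have hmain := le_of_mul_le_mul_left hsum hC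
    refine hmain.trans ?_
    rw [card_insert_of_notMem ha₀]
    have hih : Real.exp (l ^ 2 / 2) * ∑ Ψ : ι₁ → ι₂ → (Fin k → Fin n × Bool), Real.exp (l * S' Ψ) ≤
        Real.exp (l ^ 2 / 2) * (Real.exp (J'.card * l ^ 2 / 2) *
          Fintype.card (ι₁ → ι₂ → (Fin k → Fin n × Bool))) :=
      mul_le_mul_of_nonneg_left ih' (Real.exp_pos _).le
    refine hih.trans (le_of_eq ?_)
    rw [← mul_assoc, ← Real.exp_add]
    congr 1
    push_cast
    ring_nf

/-- **The conditional Hoeffding bound for violated tail clauses.** If the assignment `σ Ψ` does not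
depend on the coordinates `(ρ a, a)`, `a ∈ J ≠ ∅`, of `Ψ`, then for every `t ≥ 0` the number of families
`Ψ` with at least `2^{-k}·#J + t` columns `a ∈ J` whose clause `Ψ (ρ a) a` is violated by `σ Ψ` is at
most `exp(-t²/(2·#J)) · #families`. -/
theorem sissDL_card_violTail_le {ι₁ ι₂ : Type*} [Fintype ι₁] [DecidableEq ι₁] [Fintype ι₂]
    [DecidableEq ι₂] (hn : 1 ≤ n) (J : Finset ι₂) (hJ : 0 < J.card) (ρ : ι₂ → ι₁) (t : ℝ) (ht : 0 ≤ t)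
    (σ : (ι₁ → ι₂ → (Fin k → Fin n × Bool)) → (Fin n → Bool))
    (hσ : ∀ a ∈ J, ∀ (Ψ : ι₁ → ι₂ → (Fin k → Fin n × Bool)) (c : Fin k → Fin n × Bool),
      σ (Function.update Ψ (ρ a) (Function.update (Ψ (ρ a)) a c)) = σ Ψ) :
    (((univ : Finset (ι₁ → ι₂ → (Fin k → Fin n × Bool))).filter fun Ψ =>
        (n : ℝ) ^ k / (2 * (n : ℝ)) ^ k * J.card + t ≤
          ((J.filter fun a => ∀ b, σ Ψ ((Ψ (ρ a) a b).1) ≠ (Ψ (ρ a) a b).2).card : ℝ)).card : ℝ) ≤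
      Real.exp (-(t ^ 2 / (2 * J.card))) * Fintype.card (ι₁ → ι₂ → (Fin k → Fin n × Bool)) := by
  set p : ℝ := (n : ℝ) ^ k / (2 * (n : ℝ)) ^ k with hp
  have hJR : (0 : ℝ) < J.card := by exact_mod_cast hJ
  set l : ℝ := t / J.card with hl
  have hl0 : 0 ≤ l := by positivity
  set E := (univ : Finset (ι₁ → ι₂ → (Fin k → Fin n × Bool))).filter fun Ψ =>
      p * J.card + t ≤ ((J.filter fun a => ∀ b, σ Ψ ((Ψ (ρ a) a b).1) ≠ (Ψ (ρ a) a b).2).card : ℝ)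
    with hE
  -- the centred count
  have hcentred : ∀ Ψ : ι₁ → ι₂ → (Fin k → Fin n × Bool),
      ∑ a ∈ J, ((if ∀ b, σ Ψ ((Ψ (ρ a) a b).1) ≠ (Ψ (ρ a) a b).2 then (1 : ℝ) else 0) - p) =
        ((J.filter fun a => ∀ b, σ Ψ ((Ψ (ρ a) a b).1) ≠ (Ψ (ρ a) a b).2).card : ℝ) - p * J.card := by
    intro Ψ
    rw [sum_sub_distrib, sum_const, nsmul_eq_mul, Finset.natCast_card_filter]
    ring
  -- Markov
  have h1 : (E.card : ℝ) * Real.exp (l * t) ≤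
      ∑ Ψ : ι₁ → ι₂ → (Fin k → Fin n × Bool), Real.exp (l * ∑ a ∈ J,
        ((if ∀ b, σ Ψ ((Ψ (ρ a) a b).1) ≠ (Ψ (ρ a) a b).2 then (1 : ℝ) else 0) - p)) := by
    rw [← nsmul_eq_mul, ← sum_const]
    refine (sum_le_sum fun Ψ hΨ => ?_).trans
      (sum_le_sum_of_subset_of_nonneg (filter_subset _ _) fun Ψ _ _ => (Real.exp_pos _).le)
    rw [hE, mem_filter] at hΨ
    rw [hcentred]
    exact Real.exp_le_exp.2 (mul_le_mul_of_nonneg_left (by linarith [hΨ.2]) hl0)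
  have h2 := sissDL_expMoment_le hn l J ρ σ hσ
  have h3 : (E.card : ℝ) * Real.exp (l * t) ≤
      Real.exp (J.card * l ^ 2 / 2) * Fintype.card (ι₁ → ι₂ → (Fin k → Fin n × Bool)) := h1.trans h2
  have h4 : (E.card : ℝ) ≤ Real.exp (J.card * l ^ 2 / 2 - l * t) *
      Fintype.card (ι₁ → ι₂ → (Fin k → Fin n × Bool)) := by
    rw [Real.exp_sub, div_mul_eq_mul_div, le_div_iff₀ (Real.exp_pos _)]
    exact h3
  have h5 : (J.card : ℝ) * l ^ 2 / 2 - l * t = -(t ^ 2 / (2 * J.card)) := by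
    rw [hl]; field_simp; ring
  rw [h5] at h4
  exact h4

/-- **The conditional Hoeffding bound for violated tail clauses of a path tuple** (the registered
form of `sissDL_card_violTail_le`, on Bresler–Huang path tuples `Ψ : Fin (k+1) → Fin m → clauses`): if
the assignment `σ Ψ` does not read the rows `(ρ a, a)`, `a ∈ J ≠ ∅`, then for every `t ≥ 0` at most
`exp(-t²/(2·#J))·#tuples` tuples have `≥ 2^{-k}·#J + t` of these rows violated by `σ Ψ`. -/
theorem sissDL_card_violTail_paths_le {k m n : ℕ} (hn : 1 ≤ n) (J : Finset (Fin m)) (hJ : 0 < J.card)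
    (ρ : Fin m → Fin (k + 1)) (t : ℝ) (ht : 0 ≤ t)
    (σ : (Fin (k + 1) → Fin m → Fin k → Fin n × Bool) → (Fin n → Bool))
    (hσ : ∀ a ∈ J, ∀ (Ψ : Fin (k + 1) → Fin m → Fin k → Fin n × Bool) (c : Fin k → Fin n × Bool),
      σ (Function.update Ψ (ρ a) (Function.update (Ψ (ρ a)) a c)) = σ Ψ) :
    (((univ : Finset (Fin (k + 1) → Fin m → Fin k → Fin n × Bool)).filter fun Ψ =>
        (n : ℝ) ^ k / (2 * (n : ℝ)) ^ k * J.card + t ≤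
          ((J.filter fun a => ∀ b : Fin k, σ Ψ ((Ψ (ρ a) a b).1) ≠ (Ψ (ρ a) a b).2).card : ℝ)).card : ℝ)
      ≤ Real.exp (-(t ^ 2 / (2 * J.card))) *
        Fintype.card (Fin (k + 1) → Fin m → Fin k → Fin n × Bool) :=
  sissDL_card_violTail_le hn J hJ ρ t ht σ hσ

end DensityLiftHoeffding

end Summit.PneNP.PneNP.Theorems
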